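import Literature.MathematicalPhysics.QuantumManyBody.BoseEinsteinCondensation
import Mathlib.Analysis.SpecialFunctions.Trigonometric.Basic
import Mathlib.MeasureTheory.Integral.Bochner.ContinuousLinearMap
import Mathlib.MeasureTheory.Measure.WithDensity
import Mathlib.MeasureTheory.Function.L2Space
import Mathlib.MeasureTheory.Integral.MeanInequalities
import HarnessLib

/-!
# The static structure factor (density-wave variance) of an `N`-body state

Topic `Literature/MathematicalPhysics/QuantumManyBody` (definition item `defn-structureFactorVar`,
wanted by route BECSwapAffinity of `AtomisticToContinuum/BoseEinsteinCondensation`, crux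
GroundStateHyperuniformity = stmt-AtomisticToContinuum-3978 and stmt-…-3977, which inline the
term defined here verbatim).

For `N` particles at positions `X = (x₁, …, x_N) ∈ (ℝ³)^N` and a wave vector `k`, the
**density-wave observable** (collective density variable) is
`ρ̂_k(X) = ∑_{j=1}^N e^{i k·x_j}` [cite: TorquatoStillinger2003, §6 (collective density
variables `ρ(k) = ∑_j exp(i k·r_j)`)]; in a box of side `L` the admissible wave vectors are
`k = (2π/L) m`, `m ∈ ℤ³`. The **static structure factor** of an `N`-body state is
`S(k) = N⁻¹ ⟨ρ̂_k† ρ̂_k⟩` taken for the *fluctuation* `ρ̂_k - ⟨ρ̂_k⟩` [cite: Stringari1995, §2.2,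
text after (9): "`S(q) = N⁻¹⟨ρ_q† ρ_q⟩` is the static structure function", with the standing
convention `⟨A⟩ = ⟨B⟩ = 0` of §2.1 after (3)], i.e. `N S_N(k) = Var_{|Ψ|²}(ρ̂_k) =
⟨|ρ̂_k|²⟩ - |⟨ρ̂_k⟩|²` (for translation-invariant states and `k ≠ 0` the mean vanishes and this
is Feynman's `N⁻¹⟨|∑_j e^{ik·x_j}|²⟩` [cite: Feynman1954]). It enters the Onsager–Price /
Pitaevskii–Stringari uncertainty (Schwarz) inequalities `n(q) ≥ n₀/(4S(q)) - 1/2` and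
`S(q) ≤ (∫ ω S(q,ω) dω · ∫ ω⁻¹ S(q,ω) dω)^{1/2}`, whence `S(q) ≤ q/2mc` at small `q`
[cite: Stringari1995, §2.2 (9)–(11)] [cite: PitaevskiiStringari1991], and *hyperuniformity* of a
point process means `lim_{k→0} S(k) = 0` [cite: TorquatoStillinger2003, §2.3 (definition of
"hyperuniform": `A = lim_{|k|→0} S(k) = 0`) and §2.1 (`S(k) = 1 + ρ h̃(k) ≥ 0`)].

## Main definitions (namespace `Literature.MathematicalPhysics.QuantumManyBody.BoseGas`)

* `densityWave N L m X = ∑_j exp(I · (2π/L) ∑_t m_t (X j)_t)` — `ρ̂_k(X)`, `k = 2πm/L`.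
* `structureFactorVar N L Ψ m = ⨅ c : ℂ, ∫⁻ X, ‖ρ̂_k(X) - c‖₊² ‖Ψ X‖₊²` — **`N` times the static
  structure factor** `N S_N(k)` of the state `|Ψ|² dX`, written *junk-free* as the infimum over
  centres `c` of the mean-square deviation of `ρ̂_k`: no normalisation or measurability of `Ψ`
  is needed to state it, and for a normalised a.e.-measurable `Ψ` the infimum is attained at
  the mean, `structureFactorVar = ∫ |ρ̂_k - ⟨ρ̂_k⟩|² |Ψ|²` (`structureFactorVar_eq_lintegral_sub_mean`),
  the genuine variance. The body is *syntactically* the term inlined in the route items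
  (checked by `Iff.rfl` against `GroundStateHyperuniformity` in a scratch file), so provers may
  `show`/`change` freely. `S_N(k)` itself is `structureFactorVar / N`.
* `bornMeasure Ψ = |Ψ|² dX` — the Born law of the configuration, used to phrase means.

## API

* `structureFactorVar_le_lintegral` (every centre bounds it), `structureFactorVar_le_sq_mul`,
  `structureFactorVar_le_sq` / `TrialState.structureFactorVar_le` (`N S_N(k) ≤ N²`),
  `structureFactorVar_zero` (`k = 0`: no fluctuation), `structureFactorVar_ne_top`.
* `structureFactorVar_eq_lintegral_sub_mean`, `lintegral_densityWave_sub_sq_eq` (bias–variance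
  decomposition `∫|ρ̂_k - c|²|Ψ|² = N S_N(k) + |⟨ρ̂_k⟩ - c|²`), from the general Hilbert-space
  lemmas `lintegral_nnnorm_sub_sq_eq_add`, `iInf_lintegral_nnnorm_sub_sq_eq` (probability
  measure, `f ∈ L²`).
* `structureFactorVar_rpow_le_add`: `L²`-Lipschitz continuity
  `(N S_N(k))_Ψ^{1/2} ≤ (N S_N(k))_Φ^{1/2} + 2N ‖Ψ - Φ‖₂` (Minkowski), via the centre-wise
  bound `lintegral_densityWave_sub_sq_rpow_le`.

## Design notes

* `ℝ≥0∞`-valued lower Lebesgue integrals over the whole configuration space with Lebesgue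
  measure, as in `BoseGas.energy` / `TrialState.norm_eq` (Dirichlet trial states vanish off the
  box, so this is the box integral); the wave vector is carried by `m ∈ ℤ³` and the quantisation
  length `L`, exactly as the requesting items do. Mathlib has `ProbabilityTheory.variance` for
  real random variables but no complex/`ℝ≥0∞` centre-infimum form and nothing many-body
  (searched `structureFactor`, `densityWave`, `variance` + `iInf`); the lattice
  `QuantumLattice.SpinLiquid.structureFactor` and the KLS `hcStructureFactor` of
  `Literature/Barriers` are spin-system objects, unrelated in type.

## References

* [Stringari1995] S. Stringari, *Sum rules and Bose–Einstein condensation*, in: A. Griffin,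
  D. W. Snoke, S. Stringari (eds.), Bose–Einstein Condensation, CUP 1995, pp. 86–98, §2.2
  (8)–(11) (held: book:griffin1995-bose-einstein-condensation, PDF pp. 73–74).
* [PitaevskiiStringari1991] L. Pitaevskii, S. Stringari, *Uncertainty principle, quantum
  fluctuations, and broken symmetries*, J. Low Temp. Phys. 85 (1991) 377–388,
  doi:10.1007/BF00682193 (the original of (9)–(11)).
* [TorquatoStillinger2003] S. Torquato, F. H. Stillinger, *Local density fluctuations,
  hyperuniformity, and order metrics*, Phys. Rev. E 68 (2003) 041113, arXiv:cond-mat/0311532,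
  §2.1, §2.3, §6.
* [Feynman1954] R. P. Feynman, *Atomic theory of the two-fluid model of liquid helium*,
  Phys. Rev. 94 (1954) 262–277.
-/

noncomputable section

open MeasureTheory Filter
open scoped ENNReal NNReal ComplexConjugate

namespace Literature.MathematicalPhysics.QuantumManyBody.BoseGas

variable {N : ℕ}

/-! ### A Hilbert-space lemma: the mean minimises the mean-square deviation -/

section MeanSquare

variable {α : Type*} [MeasurableSpace α] (μ : Measure α) [IsProbabilityMeasure μ] {f : α → ℂ}

/-- **Pythagoras for the mean** (bias–variance decomposition). For a probability measure `μ`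
and `f ∈ L²(μ; ℂ)`, `∫ |f - c|² dμ = ∫ |f - ∫f|² dμ + |∫f - c|²` for every centre `c ∈ ℂ`,
stated with lower Lebesgue integrals. [folklore] -/
theorem lintegral_nnnorm_sub_sq_eq_add (hf : MemLp f 2 μ) (c : ℂ) :
    ∫⁻ x, (‖f x - c‖₊ : ℝ≥0∞) ^ 2 ∂μ =
      (∫⁻ x, (‖f x - ∫ y, f y ∂μ‖₊ : ℝ≥0∞) ^ 2 ∂μ) + (‖(∫ y, f y ∂μ) - c‖₊ : ℝ≥0∞) ^ 2 := by
  set M : ℂ := ∫ y, f y ∂μ with hM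
  have hfi : Integrable f μ := hf.integrable one_le_two
  have hsq : ∀ d : ℂ, Integrable (fun x => ‖f x - d‖ ^ 2) μ := fun d =>
    (memLp_two_iff_integrable_sq_norm (hf.1.sub aestronglyMeasurable_const)).1
      (hf.sub (memLp_const d))
  -- pointwise bias–variance identity
  have hpt : ∀ x, ‖f x - c‖ ^ 2 =
      (‖f x - M‖ ^ 2 + ‖M - c‖ ^ 2) + 2 * ((f x - M) * conj (M - c)).re := by
    intro x
    have : f x - c = (f x - M) + (M - c) := by ring
    rw [this, ← Complex.normSq_eq_norm_sq, Complex.normSq_add, Complex.normSq_eq_norm_sq,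
      Complex.normSq_eq_norm_sq]
  -- the cross term integrates to zero
  have hci : Integrable (fun x => (f x - M) * conj (M - c)) μ :=
    (hfi.sub (integrable_const M)).mul_const _
  have hcross : ∫ x, ((f x - M) * conj (M - c)).re ∂μ = 0 := by
    have h1 : ∫ x, ((f x - M) * conj (M - c)).re ∂μ = (∫ x, (f x - M) * conj (M - c) ∂μ).re := by
      simpa using integral_re hci
    rw [h1, integral_mul_const, integral_sub hfi (integrable_const M), integral_const]
    simp [hM]
  have hi1 : Integrable (fun x => ‖f x - M‖ ^ 2 + ‖M - c‖ ^ 2) μ := (hsq M).add (integrable_const _)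
  have hi2 : Integrable (fun x => 2 * ((f x - M) * conj (M - c)).re) μ := by
    simpa using hci.re.const_mul 2
  have hint : ∫ x, ‖f x - c‖ ^ 2 ∂μ = (∫ x, ‖f x - M‖ ^ 2 ∂μ) + ‖M - c‖ ^ 2 := by
    simp_rw [hpt]
    rw [integral_add hi1 hi2, integral_add (hsq M) (integrable_const _), integral_const_mul, hcross,
      integral_const]
    simp
  have hconv : ∀ d : ℂ, ∫⁻ x, (‖f x - d‖₊ : ℝ≥0∞) ^ 2 ∂μ = ENNReal.ofReal (∫ x, ‖f x - d‖ ^ 2 ∂μ) := by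
    intro d
    rw [ofReal_integral_eq_lintegral_ofReal (hsq d) (Eventually.of_forall fun x => by positivity)]
    refine lintegral_congr fun x => ?_
    rw [ENNReal.ofReal_pow (norm_nonneg _), ofReal_norm, enorm_eq_nnnorm]
  rw [hconv c, hconv M, hint, ENNReal.ofReal_add (integral_nonneg fun x => by positivity)
    (by positivity), ENNReal.ofReal_pow (norm_nonneg _), ofReal_norm, enorm_eq_nnnorm]

/-- The mean minimises the mean-square deviation: `∫ |f - ∫f|² dμ ≤ ∫ |f - c|² dμ`. [folklore] -/
theorem lintegral_nnnorm_sub_integral_sq_le (hf : MemLp f 2 μ) (c : ℂ) :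
    ∫⁻ x, (‖f x - ∫ y, f y ∂μ‖₊ : ℝ≥0∞) ^ 2 ∂μ ≤ ∫⁻ x, (‖f x - c‖₊ : ℝ≥0∞) ^ 2 ∂μ := by
  rw [lintegral_nnnorm_sub_sq_eq_add μ hf c]
  exact le_self_add

/-- The variance as an infimum over centres: `inf_c ∫ |f - c|² dμ = ∫ |f - ∫f|² dμ` for a
probability measure `μ` and `f ∈ L²(μ; ℂ)`. [folklore] -/
theorem iInf_lintegral_nnnorm_sub_sq_eq (hf : MemLp f 2 μ) :
    ⨅ c : ℂ, ∫⁻ x, (‖f x - c‖₊ : ℝ≥0∞) ^ 2 ∂μ = ∫⁻ x, (‖f x - ∫ y, f y ∂μ‖₊ : ℝ≥0∞) ^ 2 ∂μ :=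
  le_antisymm (iInf_le _ _) (le_iInf fun c => lintegral_nnnorm_sub_integral_sq_le μ hf c)

end MeanSquare

/-! ### The Born law of the configuration -/

/-- The **Born law** `|Ψ(X)|² dX` of the configuration `X ∈ (ℝ³)^N` in the (wave-function)
state `Ψ`: Lebesgue measure with density `|Ψ|²`; a probability measure iff `∫ |Ψ|² = 1`.
[folklore] -/
def bornMeasure (Ψ : Config N → ℂ) : Measure (Config N) :=
  volume.withDensity fun X => (‖Ψ X‖₊ : ℝ≥0∞) ^ 2

/-- Unfolding of `bornMeasure`. [folklore] -/
theorem bornMeasure_def (Ψ : Config N → ℂ) :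
    bornMeasure Ψ = volume.withDensity fun X => (‖Ψ X‖₊ : ℝ≥0∞) ^ 2 := rfl

/-- The total mass of the Born law is `∫ |Ψ|²`. [folklore] -/
@[simp] theorem bornMeasure_univ (Ψ : Config N → ℂ) :
    bornMeasure Ψ Set.univ = ∫⁻ X, (‖Ψ X‖₊ : ℝ≥0∞) ^ 2 := by
  rw [bornMeasure, withDensity_apply _ MeasurableSet.univ, Measure.restrict_univ]

/-- The Born law of a normalised state is a probability measure. [folklore] -/
theorem isProbabilityMeasure_bornMeasure {Ψ : Config N → ℂ}
    (h : ∫⁻ X, (‖Ψ X‖₊ : ℝ≥0∞) ^ 2 = 1) : IsProbabilityMeasure (bornMeasure Ψ) :=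
  ⟨by rw [bornMeasure_univ, h]⟩

/-- The Born law of a (normalised) trial state is a probability measure. [folklore] -/
instance (L : ℝ) (Ψ : TrialState N L) : IsProbabilityMeasure (bornMeasure Ψ.ψ) :=
  isProbabilityMeasure_bornMeasure Ψ.norm_eq

/-- Integration against the Born law is integration against `|Ψ|² dX` (no measurability of the
integrand needed; `Ψ` a.e.-measurable). [folklore] -/
theorem lintegral_bornMeasure {Ψ : Config N → ℂ} (hΨ : AEMeasurable Ψ) (g : Config N → ℝ≥0∞) :
    ∫⁻ X, g X ∂(bornMeasure Ψ) = ∫⁻ X, g X * (‖Ψ X‖₊ : ℝ≥0∞) ^ 2 := by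
  rw [bornMeasure, lintegral_withDensity_eq_lintegral_mul_non_measurable₀ _
    (hΨ.nnnorm.coe_nnreal_ennreal.pow_const 2) (Eventually.of_forall fun X => by simp)]
  simp_rw [Pi.mul_apply, mul_comm]

/-- Bochner integration against the Born law: `∫ g d(|Ψ|²dX) = ∫ |Ψ(X)|² • g(X) dX`. [folklore] -/
theorem integral_bornMeasure {E : Type*} [NormedAddCommGroup E] [NormedSpace ℝ E]
    {Ψ : Config N → ℂ} (hΨ : AEMeasurable Ψ) (g : Config N → E) :
    ∫ X, g X ∂(bornMeasure Ψ) = ∫ X, (‖Ψ X‖ ^ 2) • g X := by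
  have h : (fun X => (‖Ψ X‖₊ : ℝ≥0∞) ^ 2) = fun X => ((‖Ψ X‖₊ ^ 2 : ℝ≥0) : ℝ≥0∞) := by
    funext X; simp
  rw [bornMeasure, h, integral_withDensity_eq_integral_smul₀ (hΨ.nnnorm.pow_const 2)]
  simp_rw [NNReal.smul_def, NNReal.coe_pow, coe_nnnorm]

/-! ### The density-wave observable and the structure factor -/

/-- The **density-wave observable** (collective density variable)
`ρ̂_k(X) = ∑_{j=1}^N e^{i k·x_j}` of `N` particles at the wave vector `k = (2π/L) m`, `m ∈ ℤ³`
(the `m`-th Fourier coefficient of the empirical measure `∑_j δ_{x_j}` on the torus of side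
`L`; here `k·x_j = (2π/L) ∑_t m_t (x_j)_t`).
[cite: TorquatoStillinger2003, §6 (`ρ(k) = ∑_{j=1}^N exp(i k·r_j)`)] -/
def densityWave (N : ℕ) (L : ℝ) (m : Fin 3 → ℤ) (X : Config N) : ℂ :=
  ∑ j : Fin N, Complex.exp (Complex.I * ↑(2 * Real.pi / L * ∑ t : Fin 3, (m t : ℝ) * X j t))

/-- Unfolding of `densityWave`. [folklore] -/
theorem densityWave_eq_sum (L : ℝ) (m : Fin 3 → ℤ) (X : Config N) :
    densityWave N L m X =
      ∑ j : Fin N, Complex.exp (Complex.I * ↑(2 * Real.pi / L * ∑ t : Fin 3, (m t : ℝ) * X j t)) :=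
  rfl

/-- At `m = 0` the density wave is the particle number: `ρ̂_0 = N`. [folklore] -/
@[simp] theorem densityWave_zero (L : ℝ) (X : Config N) : densityWave N L 0 X = N := by
  simp [densityWave]

/-- `|ρ̂_k(X)| ≤ N` (a sum of `N` phases). [folklore] -/
theorem norm_densityWave_le (L : ℝ) (m : Fin 3 → ℤ) (X : Config N) :
    ‖densityWave N L m X‖ ≤ N := by
  unfold densityWave
  refine (norm_sum_le _ _).trans_eq ?_
  simp [Complex.norm_exp]

/-- `‖ρ̂_k(X)‖₊ ≤ N` in `ℝ≥0∞`. [folklore] -/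
theorem nnnorm_densityWave_le (L : ℝ) (m : Fin 3 → ℤ) (X : Config N) :
    (‖densityWave N L m X‖₊ : ℝ≥0∞) ≤ N := by
  rw [← ENNReal.coe_natCast, ENNReal.coe_le_coe, ← NNReal.coe_le_coe, coe_nnnorm,
    NNReal.coe_natCast]
  exact norm_densityWave_le L m X

/-- `ρ̂_k` is continuous on configuration space. [folklore] -/
theorem continuous_densityWave (L : ℝ) (m : Fin 3 → ℤ) : Continuous (densityWave N L m) := by
  unfold densityWave
  refine continuous_finsetSum _ fun j _ => Complex.continuous_exp.comp
    (continuous_const.mul (Complex.continuous_ofReal.comp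
      (continuous_const.mul (continuous_finsetSum _ fun t _ => continuous_const.mul ?_))))
  fun_prop

/-- `ρ̂_k` is (Borel) measurable. [folklore] -/
theorem measurable_densityWave (L : ℝ) (m : Fin 3 → ℤ) : Measurable (densityWave N L m) :=
  (continuous_densityWave L m).measurable

/-- `ρ̂_k ∈ L²` (indeed `L^∞`) for every finite measure on configuration space. [folklore] -/
theorem memLp_densityWave (L : ℝ) (m : Fin 3 → ℤ) (μ : Measure (Config N)) [IsFiniteMeasure μ] :
    MemLp (densityWave N L m) 2 μ :=
  MemLp.of_bound (continuous_densityWave L m).aestronglyMeasurable N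
    (Eventually.of_forall (norm_densityWave_le L m))

/-- **`N` times the static structure factor**, `N · S_N(k)`, of the `N`-body state `Ψ` at the
wave vector `k = (2π/L) m`, `m ∈ ℤ³`: the variance `⟨|ρ̂_k|²⟩ - |⟨ρ̂_k⟩|²` of the density-wave
observable `ρ̂_k = ∑_j e^{i k·x_j}` in the Born law `|Ψ|² dX`, written junk-free as the infimum
over centres `c ∈ ℂ` of the mean-square deviation `∫ |ρ̂_k(X) - c|² |Ψ(X)|² dX` (no
normalisation or measurability of `Ψ` is presupposed; for a normalised a.e.-measurable `Ψ` the
infimum is attained at the mean `c = ⟨ρ̂_k⟩ = ∫ ρ̂_k |Ψ|²`, see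
`structureFactorVar_eq_lintegral_sub_mean`). The static structure factor itself is
`S_N(k) = structureFactorVar N L Ψ m / N`; `S(q) = N⁻¹⟨ρ_q† ρ_q⟩` for the fluctuation operator
`ρ_q - ⟨ρ_q⟩` [cite: Stringari1995, §2.2, after (9); convention `⟨A⟩ = ⟨B⟩ = 0` of §2.1]
[cite: PitaevskiiStringari1991]; hyperuniformity is `S(k) → 0` as `k → 0`
[cite: TorquatoStillinger2003, §2.3]. The body is verbatim the term inlined in
stmt-AtomisticToContinuum-3977/3978 (route BECSwapAffinity). -/
def structureFactorVar (N : ℕ) (L : ℝ) (Ψ : Config N → ℂ) (m : Fin 3 → ℤ) : ℝ≥0∞ :=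
  ⨅ c : ℂ, ∫⁻ X, (‖(∑ j : Fin N, Complex.exp (Complex.I * ↑(2 * Real.pi / L *
    ∑ t : Fin 3, (m t : ℝ) * X j t))) - c‖₊ : ENNReal) ^ 2 * (‖Ψ X‖₊ : ENNReal) ^ 2

/-- Unfolding: `structureFactorVar` is the infimum over centres of the `|Ψ|²`-weighted
mean-square deviation of the density wave. [folklore] -/
theorem structureFactorVar_eq_iInf (L : ℝ) (Ψ : Config N → ℂ) (m : Fin 3 → ℤ) :
    structureFactorVar N L Ψ m =
      ⨅ c : ℂ, ∫⁻ X, (‖densityWave N L m X - c‖₊ : ℝ≥0∞) ^ 2 * (‖Ψ X‖₊ : ℝ≥0∞) ^ 2 :=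
  rfl

/-- The same, integrating against the Born law `|Ψ|² dX`. [folklore] -/
theorem structureFactorVar_eq_iInf_bornMeasure (L : ℝ) {Ψ : Config N → ℂ} (hΨ : AEMeasurable Ψ)
    (m : Fin 3 → ℤ) :
    structureFactorVar N L Ψ m =
      ⨅ c : ℂ, ∫⁻ X, (‖densityWave N L m X - c‖₊ : ℝ≥0∞) ^ 2 ∂(bornMeasure Ψ) := by
  simp_rw [structureFactorVar_eq_iInf, lintegral_bornMeasure hΨ]

/-- Every centre gives an upper bound: `N S_N(k) ≤ ∫ |ρ̂_k - c|² |Ψ|²`. [folklore] -/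
theorem structureFactorVar_le_lintegral (L : ℝ) (Ψ : Config N → ℂ) (m : Fin 3 → ℤ) (c : ℂ) :
    structureFactorVar N L Ψ m ≤
      ∫⁻ X, (‖densityWave N L m X - c‖₊ : ℝ≥0∞) ^ 2 * (‖Ψ X‖₊ : ℝ≥0∞) ^ 2 :=
  iInf_le _ c

/-- The trivial bound `N S_N(k) ≤ N² ∫ |Ψ|²` (centre `c = 0`, `|ρ̂_k| ≤ N`). [folklore] -/
theorem structureFactorVar_le_sq_mul (L : ℝ) (Ψ : Config N → ℂ) (m : Fin 3 → ℤ) :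
    structureFactorVar N L Ψ m ≤ (N : ℝ≥0∞) ^ 2 * ∫⁻ X, (‖Ψ X‖₊ : ℝ≥0∞) ^ 2 := by
  refine (structureFactorVar_le_lintegral L Ψ m 0).trans ?_
  rw [← lintegral_const_mul' _ _ (ENNReal.pow_ne_top (ENNReal.natCast_ne_top N))]
  refine lintegral_mono fun X => ?_
  gcongr
  rw [sub_zero]
  exact nnnorm_densityWave_le L m X

/-- The trivial bound `N S_N(k) ≤ N²`, i.e. `S_N(k) ≤ N`, for a normalised state. [folklore] -/
theorem structureFactorVar_le_sq (L : ℝ) {Ψ : Config N → ℂ}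
    (h : ∫⁻ X, (‖Ψ X‖₊ : ℝ≥0∞) ^ 2 = 1) (m : Fin 3 → ℤ) :
    structureFactorVar N L Ψ m ≤ (N : ℝ≥0∞) ^ 2 := by
  simpa [h] using structureFactorVar_le_sq_mul L Ψ m

/-- `N S_N(k) < ∞` for a normalised state. [folklore] -/
theorem structureFactorVar_ne_top (L : ℝ) {Ψ : Config N → ℂ}
    (h : ∫⁻ X, (‖Ψ X‖₊ : ℝ≥0∞) ^ 2 = 1) (m : Fin 3 → ℤ) :
    structureFactorVar N L Ψ m ≠ ⊤ :=
  ne_top_of_le_ne_top (ENNReal.pow_ne_top (ENNReal.natCast_ne_top N)) (structureFactorVar_le_sq L h m)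

/-- No fluctuation at `k = 0`: `ρ̂_0 = N` is deterministic, so `N S_N(0) = 0` (the physical
structure factor excludes / treats separately the forward direction). [folklore] -/
@[simp] theorem structureFactorVar_zero (L : ℝ) (Ψ : Config N → ℂ) :
    structureFactorVar N L Ψ 0 = 0 := by
  refine le_antisymm ((structureFactorVar_le_lintegral L Ψ 0 N).trans_eq ?_) bot_le
  simp

/-- **The infimum is attained at the mean.** For an a.e.-measurable normalised `Ψ`,
`N S_N(k) = ∫ |ρ̂_k(X) - ⟨ρ̂_k⟩|² |Ψ(X)|² dX` with `⟨ρ̂_k⟩ = ∫ ρ̂_k |Ψ|²` the expectation in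
the Born law, i.e. `structureFactorVar` is the variance `⟨|ρ̂_k|²⟩ - |⟨ρ̂_k⟩|²` of `ρ̂_k`
[cite: Stringari1995, §2.2, after (9)]. -/
theorem structureFactorVar_eq_lintegral_sub_mean (L : ℝ) {Ψ : Config N → ℂ} (hΨ : AEMeasurable Ψ)
    (h : ∫⁻ X, (‖Ψ X‖₊ : ℝ≥0∞) ^ 2 = 1) (m : Fin 3 → ℤ) :
    structureFactorVar N L Ψ m =
      ∫⁻ X, (‖densityWave N L m X - ∫ Y, densityWave N L m Y ∂(bornMeasure Ψ)‖₊ : ℝ≥0∞) ^ 2 *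
        (‖Ψ X‖₊ : ℝ≥0∞) ^ 2 := by
  haveI := isProbabilityMeasure_bornMeasure h
  rw [structureFactorVar_eq_iInf_bornMeasure L hΨ,
    iInf_lintegral_nnnorm_sub_sq_eq _ (memLp_densityWave L m _), lintegral_bornMeasure hΨ]

/-- Bias–variance decomposition for the density wave: for every centre `c`,
`∫ |ρ̂_k - c|² |Ψ|² = N S_N(k) + |⟨ρ̂_k⟩ - c|²` (normalised a.e.-measurable `Ψ`). [folklore] -/
theorem lintegral_densityWave_sub_sq_eq (L : ℝ) {Ψ : Config N → ℂ} (hΨ : AEMeasurable Ψ)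
    (h : ∫⁻ X, (‖Ψ X‖₊ : ℝ≥0∞) ^ 2 = 1) (m : Fin 3 → ℤ) (c : ℂ) :
    ∫⁻ X, (‖densityWave N L m X - c‖₊ : ℝ≥0∞) ^ 2 * (‖Ψ X‖₊ : ℝ≥0∞) ^ 2 =
      structureFactorVar N L Ψ m +
        (‖(∫ Y, densityWave N L m Y ∂(bornMeasure Ψ)) - c‖₊ : ℝ≥0∞) ^ 2 := by
  haveI := isProbabilityMeasure_bornMeasure h
  rw [structureFactorVar_eq_lintegral_sub_mean L hΨ h, ← lintegral_bornMeasure hΨ,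
    ← lintegral_bornMeasure hΨ, lintegral_nnnorm_sub_sq_eq_add _ (memLp_densityWave L m _) c]

/-- The mean of the density wave in the Born law, as a Lebesgue integral:
`⟨ρ̂_k⟩ = ∫ |Ψ(X)|² ρ̂_k(X) dX`. [folklore] -/
theorem integral_densityWave_bornMeasure (L : ℝ) {Ψ : Config N → ℂ} (hΨ : AEMeasurable Ψ)
    (m : Fin 3 → ℤ) :
    ∫ Y, densityWave N L m Y ∂(bornMeasure Ψ) = ∫ Y, ((‖Ψ Y‖ ^ 2 : ℝ) : ℂ) * densityWave N L m Y := by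
  rw [integral_bornMeasure hΨ]
  simp_rw [Complex.real_smul]

/-- `|⟨ρ̂_k⟩| ≤ N` for a normalised state. [folklore] -/
theorem norm_integral_densityWave_le (L : ℝ) {Ψ : Config N → ℂ}
    (h : ∫⁻ X, (‖Ψ X‖₊ : ℝ≥0∞) ^ 2 = 1) (m : Fin 3 → ℤ) :
    ‖∫ Y, densityWave N L m Y ∂(bornMeasure Ψ)‖ ≤ N := by
  haveI := isProbabilityMeasure_bornMeasure h
  simpa using norm_integral_le_of_norm_le_const (Eventually.of_forall (norm_densityWave_le L m))
    (μ := bornMeasure Ψ) (f := densityWave N L m)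

/-! ### `L²`-Lipschitz dependence on the state -/

/-- Centre-wise `L²`-Lipschitz bound: for every centre `c`,
`‖(ρ̂_k - c)Ψ‖₂ ≤ ‖(ρ̂_k - c)Φ‖₂ + (N + |c|) ‖Ψ - Φ‖₂` (Minkowski and `|ρ̂_k - c| ≤ N + |c|`). [folklore] -/
theorem lintegral_densityWave_sub_sq_rpow_le (L : ℝ) (m : Fin 3 → ℤ) {Ψ Φ : Config N → ℂ}
    (hΨ : AEMeasurable Ψ) (hΦ : AEMeasurable Φ) (c : ℂ) :
    (∫⁻ X, (‖densityWave N L m X - c‖₊ : ℝ≥0∞) ^ 2 * (‖Ψ X‖₊ : ℝ≥0∞) ^ 2) ^ (1 / 2 : ℝ) ≤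
      (∫⁻ X, (‖densityWave N L m X - c‖₊ : ℝ≥0∞) ^ 2 * (‖Φ X‖₊ : ℝ≥0∞) ^ 2) ^ (1 / 2 : ℝ) +
        ((N : ℝ≥0∞) + ‖c‖₊) * (∫⁻ X, (‖Ψ X - Φ X‖₊ : ℝ≥0∞) ^ 2) ^ (1 / 2 : ℝ) := by
  set w : Config N → ℝ≥0∞ := fun X => (‖densityWave N L m X - c‖₊ : ℝ≥0∞) with hw
  have hw_meas : Measurable w :=
    ((measurable_densityWave L m).sub_const c).nnnorm.coe_nnreal_ennreal
  have hw_le : ∀ X, w X ≤ N + ‖c‖₊ := fun X =>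
    calc w X ≤ (‖densityWave N L m X‖₊ : ℝ≥0∞) + ‖c‖₊ := by
          simp only [hw]; exact_mod_cast nnnorm_sub_le _ _
      _ ≤ N + ‖c‖₊ := by gcongr; exact nnnorm_densityWave_le L m X
  set f : Config N → ℝ≥0∞ := fun X => w X * ‖Φ X‖₊ with hf
  set g : Config N → ℝ≥0∞ := fun X => w X * ‖Ψ X - Φ X‖₊ with hg
  have hf_meas : AEMeasurable f := hw_meas.aemeasurable.mul hΦ.nnnorm.coe_nnreal_ennreal
  have hg_meas : AEMeasurable g := hw_meas.aemeasurable.mul (hΨ.sub hΦ).nnnorm.coe_nnreal_ennreal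
  have h1 : ∫⁻ X, w X ^ 2 * (‖Ψ X‖₊ : ℝ≥0∞) ^ 2 ≤ ∫⁻ X, (f + g) X ^ (2 : ℝ) :=
    lintegral_mono fun X => by
      rw [ENNReal.rpow_two, ← mul_pow, Pi.add_apply, hf, hg]
      gcongr
      rw [← mul_add]
      gcongr
      exact_mod_cast nnnorm_le_insert' (Ψ X) (Φ X)
  have h2 := ENNReal.lintegral_Lp_add_le (μ := volume) hf_meas hg_meas one_le_two
  have htop : ((N : ℝ≥0∞) + ‖c‖₊) ^ 2 ≠ ⊤ := ENNReal.pow_ne_top (by simp)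
  have h3 : ∫⁻ X, g X ^ (2 : ℝ) ≤ ((N : ℝ≥0∞) + ‖c‖₊) ^ 2 * ∫⁻ X, (‖Ψ X - Φ X‖₊ : ℝ≥0∞) ^ 2 := by
    rw [← lintegral_const_mul' _ _ htop]
    refine lintegral_mono fun X => ?_
    rw [ENNReal.rpow_two, hg, mul_pow]
    gcongr
    exact hw_le X
  have h4 : ∫⁻ X, f X ^ (2 : ℝ) = ∫⁻ X, w X ^ 2 * (‖Φ X‖₊ : ℝ≥0∞) ^ 2 :=
    lintegral_congr fun X => by rw [ENNReal.rpow_two, hf, mul_pow]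
  have h5 : (((N : ℝ≥0∞) + ‖c‖₊) ^ 2) ^ (1 / 2 : ℝ) = (N : ℝ≥0∞) + ‖c‖₊ := by
    rw [← ENNReal.rpow_two, ← ENNReal.rpow_mul]
    norm_num
  calc (∫⁻ X, w X ^ 2 * (‖Ψ X‖₊ : ℝ≥0∞) ^ 2) ^ (1 / 2 : ℝ)
      ≤ (∫⁻ X, (f + g) X ^ (2 : ℝ)) ^ (1 / 2 : ℝ) := ENNReal.rpow_le_rpow h1 (by norm_num)
    _ ≤ (∫⁻ X, f X ^ (2 : ℝ)) ^ (1 / 2 : ℝ) + (∫⁻ X, g X ^ (2 : ℝ)) ^ (1 / 2 : ℝ) := h2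
    _ ≤ (∫⁻ X, w X ^ 2 * (‖Φ X‖₊ : ℝ≥0∞) ^ 2) ^ (1 / 2 : ℝ) +
          ((N : ℝ≥0∞) + ‖c‖₊) * (∫⁻ X, (‖Ψ X - Φ X‖₊ : ℝ≥0∞) ^ 2) ^ (1 / 2 : ℝ) := by
        rw [h4]
        gcongr ?_ + ?_
        · exact le_rfl
        · calc (∫⁻ X, g X ^ (2 : ℝ)) ^ (1 / 2 : ℝ)
              ≤ (((N : ℝ≥0∞) + ‖c‖₊) ^ 2 * ∫⁻ X, (‖Ψ X - Φ X‖₊ : ℝ≥0∞) ^ 2) ^ (1 / 2 : ℝ) :=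
                ENNReal.rpow_le_rpow h3 (by norm_num)
            _ = ((N : ℝ≥0∞) + ‖c‖₊) * (∫⁻ X, (‖Ψ X - Φ X‖₊ : ℝ≥0∞) ^ 2) ^ (1 / 2 : ℝ) := by
                rw [ENNReal.mul_rpow_of_nonneg _ _ (by norm_num), h5]

/-- **`L²`-Lipschitz continuity** of `Ψ ↦ (N S_N(k))^{1/2}` at a normalised state `Φ`:
`(N S_N(k))_Ψ^{1/2} ≤ (N S_N(k))_Φ^{1/2} + 2N ‖Ψ - Φ‖₂` (centre the Ψ-deviation at the
`Φ`-mean, whose modulus is `≤ N`). [folklore] -/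
theorem structureFactorVar_rpow_le_add (L : ℝ) (m : Fin 3 → ℤ) {Ψ Φ : Config N → ℂ}
    (hΨ : AEMeasurable Ψ) (hΦ : AEMeasurable Φ) (hΦ1 : ∫⁻ X, (‖Φ X‖₊ : ℝ≥0∞) ^ 2 = 1) :
    structureFactorVar N L Ψ m ^ (1 / 2 : ℝ) ≤
      structureFactorVar N L Φ m ^ (1 / 2 : ℝ) +
        2 * N * (∫⁻ X, (‖Ψ X - Φ X‖₊ : ℝ≥0∞) ^ 2) ^ (1 / 2 : ℝ) := by
  set M : ℂ := ∫ Y, densityWave N L m Y ∂(bornMeasure Φ) with hM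
  have hMle : (‖M‖₊ : ℝ≥0∞) ≤ N := by
    rw [← ENNReal.coe_natCast, ENNReal.coe_le_coe, ← NNReal.coe_le_coe, coe_nnnorm,
      NNReal.coe_natCast]
    exact norm_integral_densityWave_le L hΦ1 m
  rw [structureFactorVar_eq_lintegral_sub_mean L hΦ hΦ1 m]
  calc structureFactorVar N L Ψ m ^ (1 / 2 : ℝ)
      ≤ (∫⁻ X, (‖densityWave N L m X - M‖₊ : ℝ≥0∞) ^ 2 * (‖Ψ X‖₊ : ℝ≥0∞) ^ 2) ^ (1 / 2 : ℝ) :=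
        ENNReal.rpow_le_rpow (structureFactorVar_le_lintegral L Ψ m M) (by norm_num)
    _ ≤ (∫⁻ X, (‖densityWave N L m X - M‖₊ : ℝ≥0∞) ^ 2 * (‖Φ X‖₊ : ℝ≥0∞) ^ 2) ^ (1 / 2 : ℝ) +
          ((N : ℝ≥0∞) + ‖M‖₊) * (∫⁻ X, (‖Ψ X - Φ X‖₊ : ℝ≥0∞) ^ 2) ^ (1 / 2 : ℝ) :=
        lintegral_densityWave_sub_sq_rpow_le L m hΨ hΦ M
    _ ≤ _ := by
        gcongr
        calc (N : ℝ≥0∞) + ‖M‖₊ ≤ N + N := by gcongr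
          _ = 2 * N := (two_mul _).symm

/-! ### Trial states -/

namespace TrialState

variable {L' : ℝ} (Ψ : TrialState N L')

/-- Trial states are a.e.-measurable (they are `C¹`). [folklore] -/
theorem aemeasurable : AEMeasurable Ψ.ψ := Ψ.contDiff.continuous.measurable.aemeasurable

/-- `N S_N(k) ≤ N²` for every (normalised, Dirichlet) trial state. [folklore] -/
theorem structureFactorVar_le (L : ℝ) (m : Fin 3 → ℤ) :
    structureFactorVar N L Ψ.ψ m ≤ (N : ℝ≥0∞) ^ 2 :=
  structureFactorVar_le_sq L Ψ.norm_eq m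

/-- For a trial state the structure-factor variance is the variance of `ρ̂_k` in `|Ψ|² dX`. [folklore] -/
theorem structureFactorVar_eq (L : ℝ) (m : Fin 3 → ℤ) :
    structureFactorVar N L Ψ.ψ m =
      ∫⁻ X, (‖densityWave N L m X - ∫ Y, densityWave N L m Y ∂(bornMeasure Ψ.ψ)‖₊ : ℝ≥0∞) ^ 2 *
        (‖Ψ.ψ X‖₊ : ℝ≥0∞) ^ 2 :=
  structureFactorVar_eq_lintegral_sub_mean L Ψ.aemeasurable Ψ.norm_eq m

end TrialState

end Literature.MathematicalPhysics.QuantumManyBody.BoseGas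

end
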